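import Summits.QuantumFields.YangMills.Theorems.FlatTubeReductionOneSiteKernelOrbitMoment
import Summits.QuantumFields.YangMills.Theorems.LuscherReductionTwistedTraceScalingBOKernel
import HarnessLib

/-!
# (A5) THE SLOW FACTOR SPLITS INTO RATE + POTENTIAL: `∫ (K̃₁φ²)(u')·(a + b·orbitDist(u')²) du' ≤ ∫ φ(u)²·[(a + 2b(orbitDist(u)² + m²))·‖K̃₁(u,·)‖₁ + b(4|E₁|)²crossBound] du`
# — Fubini + the one-site orbit-moment lemma (ρ2): the `orbitDist(u)²φ(u)²` part is the POTENTIAL of `stub_hODpot_A`, the rest is rate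
# (memo `Cruxes/NearFlatRatioLaw/Lines/ratepack-v7-moments-g18.md` §5 (A5); route `FlatTubeReduction`, crux K1 `NearFlatRatioLaw` stmt-QuantumFields-24720, line «ratepack_v2» skeleton v6;
# seat `ym-line-ftr-p1` g18; R2b1 RECORD rung — no summit statement is proved here)

WHY.  After (A1)–(A3) (`…SlowCauchySchwarz.sq_slow_defect_le`, `…CoreDefectMomentSq.defect_core_sq_integral_le_moment`) the slow factor of the core `L²` defect is
`∫_{u'} (∫_u φ(u)²K̃₁(u',u)du)·Γ(u') du'` with `Γ(u') = a + b·orbitDist(u')²` (the squared first-order slow coefficients, smeared; `a` second order in the windows, `b = O(1)`).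
Swapping the integrals (Tonelli, bounded data) and smearing `Γ` with ✓`integral_orbitDist_sq_mul_avgKernel_le` around the INPUT datum `u` gives
★★ `integral_smearedSq_mul_affine_le`:
`∫_{u'}(∫_u φ(u)²K̃₁(u',u)du)(a + b·orbitDist(u')²)du' ≤ ∫_u φ(u)²·((a + 2b(orbitDist(u)² + m²))·∫_{u'}K̃₁(u,u')du' + b·(4|Edge 3 1|)²·crossBound 1 B m) du` (`a, b ≥ 0`),
i.e. RATE `(a + 2bm²)·‖K̃₁‖₁·∫φ²` + POTENTIAL `2b‖K̃₁‖₁·∫orbitDist²φ²` + far `b(4|E₁|)²crossBound·∫φ²`.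
HONEST FRAMING: elementary kernel bookkeeping for a stub of the CONDITIONAL reduction route R2b1 (rate twin); femto rung R2b1 (RECORD label); not infinite volume, not a mass gap, not Clay.
No defs, no named facts, no `sorry`.
-/

set_option autoImplicit false

noncomputable section

open MeasureTheory Filter Topology Real
open scoped BigOperators
open Literature.MathematicalPhysics.QuantumFieldTheory
open Literature.MathematicalPhysics.QuantumLattice

namespace Summit.QuantumFields.YangMills.Theorems.FemtoTransferGap.TwoLattice.ConstTube

open Summit.QuantumFields.YangMills.Theorems.FemtoTransferGap
open Summit.QuantumFields.YangMills.Theorems.FemtoTransferGap.TwoLattice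
open Summit.QuantumFields.YangMills.Theorems.FemtoTransferGap.TwoLattice.Avg

/-- ★★ **THE SLOW FACTOR SPLITS INTO RATE + POTENTIAL** (see the module docstring): for `B, m, a, b ≥ 0` and bounded measurable `φ`,
`∫_{u'}(∫_u φ(u)²·avgKernel B u' u du)(a + b·orbitDist(u')²)du' ≤ ∫_u φ(u)²·((a + 2b(orbitDist(u)² + m²))·∫_{u'} avgKernel B u u' du' + b·(4|Edge 3 1|)²·crossBound 1 B m) du`.
[folklore] -/
theorem integral_smearedSq_mul_affine_le {B m a b : ℝ} (hB : 0 ≤ B) (hm : 0 ≤ m) (ha : 0 ≤ a) (hb : 0 ≤ b) {φ : GaugeConfig 3 1 SU2 → ℝ} (hφm : Measurable φ)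
    {Cφ : ℝ} (hφb : ∀ u, |φ u| ≤ Cφ) :
    ∫ u', (∫ u, φ u ^ 2 * avgKernel B u' u ∂configMeasure SU2 1) * (a + b * orbitDist u' ^ 2) ∂configMeasure SU2 1 ≤
      ∫ u, φ u ^ 2 * ((a + 2 * b * (orbitDist u ^ 2 + m ^ 2)) * ∫ u', avgKernel B u u' ∂configMeasure SU2 1 + b * ((4 * (Fintype.card (Edge 3 1) : ℝ)) ^ 2 * crossBound 1 B m))
        ∂configMeasure SU2 1 := by
  haveI : SecondCountableTopology SU2 := secondCountableTopology_su2
  obtain ⟨M, hM⟩ := exists_transferKernel_le su2Rep continuous_su2Rep B (L := 1)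
  have hCφ : 0 ≤ Cφ := (abs_nonneg _).trans (hφb 1)
  have hK0 : ∀ u u' : GaugeConfig 3 1 SU2, 0 ≤ avgKernel B u u' := fun u u' => (avgKernel_pos _ _ _).le
  have hKM : ∀ u u' : GaugeConfig 3 1 SU2, avgKernel B u u' ≤ M := fun u u' => avgKernel_le B hM u u'
  have hM0 : 0 ≤ M := (hK0 1 1).trans (hKM 1 1)
  have hod : ∀ w : GaugeConfig 3 1 SU2, orbitDist w ^ 2 ≤ (4 * (Fintype.card (Edge 3 1) : ℝ)) ^ 2 := fun w =>
    pow_le_pow_left₀ (orbitDist_nonneg w) (orbitDist_le_four_card w) 2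
  set D : ℝ := (4 * (Fintype.card (Edge 3 1) : ℝ)) ^ 2 with hD
  have hΓ0 : ∀ w : GaugeConfig 3 1 SU2, 0 ≤ a + b * orbitDist w ^ 2 := fun w => by positivity
  have hΓb : ∀ w : GaugeConfig 3 1 SU2, a + b * orbitDist w ^ 2 ≤ a + b * D := fun w => by have := mul_le_mul_of_nonneg_left (hod w) hb; linarith
  -- the joint integrand `(u', u) ↦ φ(u)²·K̃(u',u)·Γ(u')`
  have hKm : Measurable fun p : GaugeConfig 3 1 SU2 × GaugeConfig 3 1 SU2 => avgKernel B p.1 p.2 := measurable_avgKernel B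
  have hjm : Measurable fun p : GaugeConfig 3 1 SU2 × GaugeConfig 3 1 SU2 => φ p.2 ^ 2 * avgKernel B p.1 p.2 * (a + b * orbitDist p.1 ^ 2) :=
    (((hφm.comp measurable_snd).pow_const 2).mul hKm).mul (measurable_const.add (((measurable_orbitDist.comp measurable_fst).pow_const 2).const_mul b))
  have hjb : ∀ p : GaugeConfig 3 1 SU2 × GaugeConfig 3 1 SU2, |φ p.2 ^ 2 * avgKernel B p.1 p.2 * (a + b * orbitDist p.1 ^ 2)| ≤ Cφ ^ 2 * M * (a + b * D) := fun p => by
    rw [abs_of_nonneg (mul_nonneg (mul_nonneg (sq_nonneg _) (hK0 _ _)) (hΓ0 _))]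
    have h1 : φ p.2 ^ 2 ≤ Cφ ^ 2 := by rw [← sq_abs]; exact pow_le_pow_left₀ (abs_nonneg _) (hφb _) 2
    exact mul_le_mul (mul_le_mul h1 (hKM _ _) (hK0 _ _) (sq_nonneg _)) (hΓb _) (hΓ0 _) (mul_nonneg (sq_nonneg _) hM0)
  have hjint : Integrable (fun p : GaugeConfig 3 1 SU2 × GaugeConfig 3 1 SU2 => φ p.2 ^ 2 * avgKernel B p.1 p.2 * (a + b * orbitDist p.1 ^ 2))
      ((configMeasure SU2 1).prod (configMeasure SU2 1)) := integrable_of_measurable_abs_le _ hjm hjb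
  -- rewrite the left side as an iterated integral of the joint integrand and swap
  have hL : ∫ u', (∫ u, φ u ^ 2 * avgKernel B u' u ∂configMeasure SU2 1) * (a + b * orbitDist u' ^ 2) ∂configMeasure SU2 1 =
      ∫ u', ∫ u, φ u ^ 2 * avgKernel B u' u * (a + b * orbitDist u' ^ 2) ∂configMeasure SU2 1 ∂configMeasure SU2 1 := by
    refine integral_congr_ae (ae_of_all _ fun u' => ?_); dsimp only; rw [← integral_mul_const]
  rw [hL, integral_integral_swap hjint]
  -- inner bound at fixed `u`: `∫_{u'} φ(u)²K̃(u',u)Γ(u') = φ(u)²·∫_{u'}Γ(u')K̃(u,u') ≤ φ(u)²·(…)`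
  have hKint : ∀ u : GaugeConfig 3 1 SU2, Integrable (fun u' : GaugeConfig 3 1 SU2 => avgKernel B u u') (configMeasure SU2 1) := fun u =>
    integrable_of_measurable_abs_le _ (measurable_avgKernel_right B u) (C := M) fun u' => by rw [abs_of_nonneg (hK0 _ _)]; exact hKM _ _
  have hinner : ∀ u : GaugeConfig 3 1 SU2, ∫ u', φ u ^ 2 * avgKernel B u' u * (a + b * orbitDist u' ^ 2) ∂configMeasure SU2 1 ≤
      φ u ^ 2 * ((a + 2 * b * (orbitDist u ^ 2 + m ^ 2)) * ∫ u', avgKernel B u u' ∂configMeasure SU2 1 + b * (D * crossBound 1 B m)) := by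
    intro u
    have e : (fun u' => φ u ^ 2 * avgKernel B u' u * (a + b * orbitDist u' ^ 2)) = fun u' => φ u ^ 2 * ((a + b * orbitDist u') ^ 0 * (a * avgKernel B u u') + b * (orbitDist u' ^ 2 * avgKernel B u u')) := by
      funext u'; rw [avgKernel_symm B u' u]; ring
    rw [e, integral_const_mul]
    refine mul_le_mul_of_nonneg_left ?_ (sq_nonneg _)
    have hO : Integrable (fun u' : GaugeConfig 3 1 SU2 => orbitDist u' ^ 2 * avgKernel B u u') (configMeasure SU2 1) :=
      integrable_of_measurable_abs_le _ ((measurable_orbitDist.pow_const 2).mul (measurable_avgKernel_right B u)) (C := D * M) fun u' => by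
        rw [abs_of_nonneg (mul_nonneg (sq_nonneg _) (hK0 _ _))]; exact mul_le_mul (hod u') (hKM _ _) (hK0 _ _) (by rw [hD]; positivity)
    have k1 : Integrable (fun u' : GaugeConfig 3 1 SU2 => (a + b * orbitDist u') ^ 0 * (a * avgKernel B u u')) (configMeasure SU2 1) := by
      simp only [pow_zero, one_mul]; exact (hKint u).const_mul a
    have k2 : Integrable (fun u' : GaugeConfig 3 1 SU2 => b * (orbitDist u' ^ 2 * avgKernel B u u')) (configMeasure SU2 1) := hO.const_mul b
    rw [integral_add k1 k2, integral_const_mul]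
    simp only [pow_zero, one_mul]
    rw [integral_const_mul]
    have h2 := integral_orbitDist_sq_mul_avgKernel_le hB hm u
    rw [← hD] at h2
    have h3 := mul_le_mul_of_nonneg_left h2 hb
    have hI0 : 0 ≤ ∫ u', avgKernel B u u' ∂configMeasure SU2 1 := integral_nonneg fun u' => hK0 _ _
    nlinarith [h3, hI0, ha]
  -- integrate the inner bound
  have hrhs : Integrable (fun u => φ u ^ 2 * ((a + 2 * b * (orbitDist u ^ 2 + m ^ 2)) * ∫ u', avgKernel B u u' ∂configMeasure SU2 1 + b * (D * crossBound 1 B m)))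
      (configMeasure SU2 1) := by
    have hIm : Measurable fun u : GaugeConfig 3 1 SU2 => ∫ u', avgKernel B u u' ∂configMeasure SU2 1 :=
      (hKm.stronglyMeasurable.integral_prod_right' (ν := configMeasure SU2 1)).measurable
    have hIb : ∀ u, |∫ u', avgKernel B u u' ∂configMeasure SU2 1| ≤ M := fun u => by
      rw [abs_of_nonneg (integral_nonneg fun u' => hK0 _ _)]
      calc ∫ u', avgKernel B u u' ∂configMeasure SU2 1 ≤ ∫ _u', M ∂configMeasure SU2 1 := integral_mono (hKint u) (integrable_const _) fun u' => hKM _ _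
        _ = M := by rw [integral_const, smul_eq_mul, probReal_univ, one_mul]
    have hcb0 : 0 ≤ crossBound 1 B m := (crossBound_pos (L := 1) B m).le
    refine integrable_of_measurable_abs_le _ ((hφm.pow_const 2).mul (((measurable_const.add (((measurable_orbitDist.pow_const 2).add measurable_const).const_mul _)).mul hIm).add measurable_const))
      (C := Cφ ^ 2 * ((a + 2 * b * (D + m ^ 2)) * M + b * (D * crossBound 1 B m))) fun u => ?_
    have hΓu0 : 0 ≤ a + 2 * b * (orbitDist u ^ 2 + m ^ 2) := by positivity
    have hIu0 : 0 ≤ ∫ u', avgKernel B u u' ∂configMeasure SU2 1 := integral_nonneg fun u' => hK0 _ _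
    rw [abs_of_nonneg (mul_nonneg (sq_nonneg _) (add_nonneg (mul_nonneg hΓu0 hIu0) (by positivity)))]
    have h1 : φ u ^ 2 ≤ Cφ ^ 2 := by rw [← sq_abs]; exact pow_le_pow_left₀ (abs_nonneg _) (hφb _) 2
    have h2 : (a + 2 * b * (orbitDist u ^ 2 + m ^ 2)) * ∫ u', avgKernel B u u' ∂configMeasure SU2 1 ≤ (a + 2 * b * (D + m ^ 2)) * M :=
      mul_le_mul (by nlinarith [hod u]) ((le_abs_self _).trans (hIb u)) hIu0 (by positivity)
    exact mul_le_mul h1 (by linarith) (add_nonneg (mul_nonneg hΓu0 hIu0) (by positivity)) (sq_nonneg _)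
  have hlhs : Integrable (fun u => ∫ u', φ u ^ 2 * avgKernel B u' u * (a + b * orbitDist u' ^ 2) ∂configMeasure SU2 1) (configMeasure SU2 1) := hjint.integral_prod_right
  rw [hD] at hinner hrhs
  exact integral_mono hlhs hrhs hinner

end Summit.QuantumFields.YangMills.Theorems.FemtoTransferGap.TwoLattice.ConstTube

end
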